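import Literature.Probability.Percolation.StaircaseCells
import Literature.Probability.Percolation.StaircaseArcs
import HarnessLib

/-!
# Key gaps of the schedule give index gaps on every ring

Topic: Probability / Percolation; family `crit-perc`. A brick of the GENERIC landing layer of
Nolin's arm-separation theorem (Nolin 2008, Thm. 11, §4.4 [arXiv 0711.4948: Thm. 10, p. 12,
Fig. 6: "RSW in corridors"]), towards
`Literature.Probability.Percolation.Nolin2008_prop17_quasiMult` (`FiveArmExponentFacts.lean`).

The usable cells `(i, a + 2)`, `i < 6`, `a < m`, of the lowest ring are numbered by the reduced
keys `κ = i m + a ∈ [0, 6m)`; on the ring with `q` more chunks per side the cell sits at the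
ring position `Staircase.idxC m q i a = cellPos (m + 4) q i (a + 2)`. This numbering is
increasing with slope at least two, also around the corner between the sides `5` and `0`
(`idxC_mono`, `idxC_first`, `idxC_last`): a gap of `d` keys is a gap of at least `2d` ring
positions. Consequently (`indexGap_of_keyGap`) a cell whose key is at cyclic key distance at
least `δ ≥ 7` from both ends of a move, on the far side of the move, is at cyclic INDEX
distance at least `12` from every position of the arc of the move — the hypothesis of
`ringTube_disjoint_of_index_gap` (`StaircaseIndexGap.lean`).

## Main results

* `Staircase.idxC_mono`, `Staircase.idxC_lt`, `Staircase.idxC_first`, `Staircase.idxC_last`;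
* `Staircase.keyReduce_add` — reduced keys of `k` and `k + d`;
* `Staircase.idxK_mono`, `Staircase.idxK_lower`, `Staircase.idxK_upper`;
* `Staircase.indexGap_of_keyGap` — the index gap along a counterclockwise move.

## References

* P. Nolin, *Near-critical percolation in two dimensions*, Electron. J. Probab. 13 (2008), §4.4
  (arXiv 0711.4948: proof of Thm. 10, p. 12, Fig. 6). [Nolin2008]
-/

noncomputable section

namespace Literature.Probability.Percolation

open LatticeModels Tube

namespace Staircase

/-- The ring position, `q` levels of chunks up, of the usable cell numbered `(i, a)`:
`cellPos (m + 4) q i (a + 2)`. [folklore] -/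
def idxC (m q i a : ℕ) : ℕ := cellPos (m + 4) q i (a + 2)

variable {m q : ℕ}

/-- **Slope two**: later usable cells (in key order) sit at least twice as many positions
further (`i' < 6`, `a < m`). [folklore] -/
theorem idxC_mono {i a i' a' : ℕ} (hi' : i' < 6) (ha : a < m) (h : i < i' ∨ (i = i' ∧ a ≤ a')) :
    idxC m q i a + 2 * (i' * m + a') ≤ idxC m q i' a' + 2 * (i * m + a) := by
  have hi : i < 6 := by omega
  unfold idxC cellPos extPos upIdx
  interval_cases i <;> interval_cases i' <;> simp only [blockOff, Nat.reduceMod, Nat.reduceEqDiff, reduceIte] <;> omega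

/-- Usable cells are ring positions (`i < 6`, `a < m`). [folklore] -/
theorem idxC_lt {i a : ℕ} (hi : i < 6) (ha : a < m) : idxC m q i a < 12 * (m + 4 + q) - 4 :=
  cellPos_lt hi (by omega)

/-- The first usable cell sits at least `4` positions into the ring. [folklore] -/
theorem idxC_first : 4 ≤ idxC m q 0 0 := by
  unfold idxC cellPos extPos upIdx; simp only [blockOff, Nat.reduceMod, Nat.reduceEqDiff, reduceIte]; omega

/-- The last usable cell sits at least `5` positions before the end of the ring (`1 ≤ m`). [folklore] -/
theorem idxC_last (hm : 1 ≤ m) : idxC m q 5 (m - 1) + 5 ≤ 12 * (m + 4 + q) - 4 := by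
  unfold idxC cellPos extPos upIdx; simp only [blockOff, Nat.reduceMod, reduceIte]; omega

/-! ### Reduced keys -/

/-- The reduced key `κ(k) ∈ [0, 6m)`. [folklore] -/
def keyReduce (m : ℕ) (k : ℤ) : ℕ := (k % (6 * m : ℕ)).toNat

/-- The reduced key of `k + d` (`0 ≤ d < 6m`): `κ + d`, minus a turn if that reaches `6m`. [folklore] -/
theorem keyReduce_add (hm : 0 < m) (k : ℤ) {d : ℤ} (hd0 : 0 ≤ d) (hdC : d < (6 * m : ℕ)) :
    keyReduce m (k + d) =
      if (keyReduce m k : ℤ) + d < (6 * m : ℕ) then keyReduce m k + d.toNat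
      else keyReduce m k + d.toNat - 6 * m := by
  unfold keyReduce
  have hC : (0 : ℤ) < (6 * m : ℕ) := by exact_mod_cast (show 0 < 6 * m by omega)
  have h0 := Int.emod_nonneg k hC.ne'
  have h1 := Int.emod_lt_of_pos k hC
  have hk : (((k % (6 * m : ℕ)).toNat : ℕ) : ℤ) = k % (6 * m : ℕ) := Int.toNat_of_nonneg h0
  have hdn : ((d.toNat : ℕ) : ℤ) = d := Int.toNat_of_nonneg hd0
  have hadd : (k + d) % (6 * m : ℕ) = (k % (6 * m : ℕ) + d) % (6 * m : ℕ) := by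
    rw [Int.add_emod, Int.emod_eq_of_lt hd0 hdC]
  rw [hadd]
  split_ifs with hlt
  · rw [hk] at hlt
    rw [Int.emod_eq_of_lt (by omega) hlt]
    omega
  · rw [hk] at hlt
    push Not at hlt
    have hq1 : (k % (6 * m : ℕ) + d) / (6 * m : ℕ) = 1 := by
      apply le_antisymm
      · have := (Int.ediv_lt_iff_lt_mul hC).2 (show k % (6 * m : ℕ) + d < 2 * (6 * m : ℕ) by omega)
        omega
      · exact (Int.le_ediv_iff_mul_le hC).2 (by omega)
    have e : (k % (6 * m : ℕ) + d) % (6 * m : ℕ) = k % (6 * m : ℕ) + d - (6 * m : ℕ) := by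
      have := Int.emod_add_mul_ediv (k % (6 * m : ℕ) + d) (6 * m : ℕ)
      rw [hq1, mul_one] at this; omega
    rw [e]
    omega

/-! ### Keys and their ring positions -/

/-- The ring position, `q` levels up, of the usable cell of the key `k`. [folklore] -/
def idxK (m q : ℕ) (k : ℤ) : ℕ := idxC m q (keySide m k) (keyRank m k)

/-- The reduced key is `side · m + rank`. [folklore] -/
theorem keyReduce_eq (k : ℤ) : keyReduce m k = keySide m k * m + keyRank m k := key_eq k

/-- The reduced key is `< 6m` (`0 < m`). [folklore] -/
theorem keyReduce_lt (hm : 0 < m) (k : ℤ) : keyReduce m k < 6 * m := key_toNat_lt hm k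

/-- Keys differing by a multiple of a turn have the same reduced key. [folklore] -/
theorem keyReduce_add_mul (k t : ℤ) : keyReduce m (k + t * (6 * m : ℕ)) = keyReduce m k := by
  unfold keyReduce; rw [Int.add_mul_emod_self_right]

/-- Keys differing by a multiple of a turn have the same cell position. [folklore] -/
theorem idxK_add_mul (k t : ℤ) : idxK m q (k + t * (6 * m : ℕ)) = idxK m q k := by
  unfold idxK keySide keyRank; rw [Int.add_mul_emod_self_right]

/-- **Slope two in the reduced key.** [folklore] -/
theorem idxK_mono (hm : 0 < m) {k k' : ℤ} (h : keyReduce m k ≤ keyReduce m k') :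
    idxK m q k + 2 * keyReduce m k' ≤ idxK m q k' + 2 * keyReduce m k := by
  rw [keyReduce_eq, keyReduce_eq] at h ⊢
  have ha := keyRank_lt hm k
  have ha' := keyRank_lt hm k'
  have hi' := keySide_lt hm k'
  refine idxC_mono hi' ha ?_
  rcases lt_trichotomy (keySide m k) (keySide m k') with hlt | heq | hgt
  · exact Or.inl hlt
  · right; refine ⟨heq, ?_⟩; rw [heq] at h; omega
  · exfalso
    have : (keySide m k' + 1) * m ≤ keySide m k * m := Nat.mul_le_mul_right _ hgt
    rw [Nat.add_mul, one_mul] at this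
    omega

/-- Every usable cell sits at least `4 + 2κ` positions into the ring. [folklore] -/
theorem idxK_lower (hm : 0 < m) (k : ℤ) : 4 + 2 * keyReduce m k ≤ idxK m q k := by
  have hlex : 0 < keySide m k ∨ (0 = keySide m k ∧ 0 ≤ keyRank m k) := by
    rcases Nat.eq_zero_or_pos (keySide m k) with h | h
    · exact Or.inr ⟨h.symm, Nat.zero_le _⟩
    · exact Or.inl h
  have h := idxC_mono (q := q) (i := 0) (a := 0) (i' := keySide m k) (a' := keyRank m k) (keySide_lt hm k) hm hlex
  have h0 := idxC_first (m := m) (q := q)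
  rw [keyReduce_eq]; unfold idxK; omega

/-- Every usable cell sits at least `2(6m - κ) + 3` positions before the end of the ring. [folklore] -/
theorem idxK_upper (hm : 0 < m) (k : ℤ) : idxK m q k + 2 * (6 * m - keyReduce m k) + 3 ≤ 12 * (m + 4 + q) - 4 := by
  have hs := keySide_lt hm k
  have ha := keyRank_lt hm k
  have hlex : keySide m k < 5 ∨ (keySide m k = 5 ∧ keyRank m k ≤ m - 1) := by
    rcases Nat.lt_or_ge (keySide m k) 5 with h | h
    · exact Or.inl h
    · exact Or.inr ⟨by omega, by omega⟩
  have h := idxC_mono (q := q) (i := keySide m k) (a := keyRank m k) (i' := 5) (a' := m - 1) (by norm_num) ha hlex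
  have hl := idxC_last (q := q) hm
  have hf : keySide m k * m ≤ 5 * m := Nat.mul_le_mul_right _ (by omega)
  rw [keyReduce_eq]; unfold idxK; omega

/-- Usable cells are ring positions. [folklore] -/
theorem idxK_lt (hm : 0 < m) (k : ℤ) : idxK m q k < 12 * (m + 4 + q) - 4 :=
  idxC_lt (keySide_lt hm k) (keyRank_lt hm k)

/-- **Key gaps give index gaps along a counterclockwise move**: for a move from the key `x` to
the key `x' ≥ x` and another key `y` at least `δ ≥ 7` beyond `x'` and at least `δ` before
`x + C` up to a number of turns (`x' + δ ≤ y + tC ≤ x + C - δ`, `C = 6m`), every position `g` of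
the counterclockwise arc from the cell of `x` to the cell of `x'` is at cyclic index distance at
least `12` from the cell of `y`. [cite: Nolin2008, §4.4 (arXiv 0711.4948: proof of Thm. 10, p. 12, Fig. 6)] -/
theorem indexGap_of_keyGap (hm : 0 < m) {δ : ℤ} (hδ : 7 ≤ δ) {x x' y : ℤ} (hxx' : x ≤ x') (t : ℤ)
    (h1 : x' + δ ≤ y + t * (6 * m : ℕ)) (h2 : y + t * (6 * m : ℕ) + δ ≤ x + (6 * m : ℕ)) {g : ℕ} (hg : g < 12 * (m + 4 + q) - 4)
    (hin : InArc (12 * (m + 4 + q) - 4) (idxK m q x) (ccwLen (12 * (m + 4 + q) - 4) (idxK m q x) (idxK m q x')) g) :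
    (g + 12 ≤ idxK m q y ∨ idxK m q y + 12 ≤ g) ∧
      (idxK m q y + 12 ≤ g + (12 * (m + 4 + q) - 4) ∧ g + 12 ≤ idxK m q y + (12 * (m + 4 + q) - 4)) := by
  -- the third key up to turns
  set y' := y + t * (6 * m : ℕ) with hy'
  have hiy : idxK m q y = idxK m q y' := (idxK_add_mul y t).symm
  have hκy : keyReduce m y' = keyReduce m y := keyReduce_add_mul y t
  rw [hiy]
  -- reduced keys of `x'` and `y'` from that of `x`
  have hC0 : 0 < 6 * m := by omega
  have hd1 := keyReduce_add hm x (d := x' - x) (by omega) (by push_cast; omega)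
  have hd2 := keyReduce_add hm x (d := y' - x) (by omega) (by push_cast; omega)
  rw [show x + (x' - x) = x' by ring] at hd1
  rw [show x + (y' - x) = y' by ring] at hd2
  have hκx := keyReduce_lt hm x
  have hκx' := keyReduce_lt hm x'
  have hκy' := keyReduce_lt hm y'
  -- positions
  have lx := idxK_lower (q := q) hm x
  have lx' := idxK_lower (q := q) hm x'
  have ly := idxK_lower (q := q) hm y'
  have ux := idxK_upper (q := q) hm x
  have ux' := idxK_upper (q := q) hm x'
  have uy := idxK_upper (q := q) hm y'
  have gx := idxK_lt (q := q) hm x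
  have gx' := idxK_lt (q := q) hm x'
  have gy := idxK_lt (q := q) hm y'
  -- monotonicity instances, both directions guarded
  have mono : ∀ k k' : ℤ, keyReduce m k ≤ keyReduce m k' → idxK m q k + 2 * keyReduce m k' ≤ idxK m q k' + 2 * keyReduce m k :=
    fun k k' h => idxK_mono hm h
  have m1 := mono x x'
  have m1' := mono x' x
  have m2 := mono x y'
  have m2' := mono y' x
  have m3 := mono x' y'
  have m3' := mono y' x'
  -- offsets without `%` (the closed form `add_sub_mod_eq_ite` of `PeriodicBoxRooting.lean`, inlined)
  have offset_eq : ∀ {G a g : ℕ}, a < G → g < G → (g + G - a) % G = if a ≤ g then g - a else g + G - a := by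
    intro G a g ha hg
    split_ifs with h
    · rw [show g + G - a = (g - a) + G by omega, Nat.add_mod_right, Nat.mod_eq_of_lt (by omega)]
    · exact Nat.mod_eq_of_lt (by omega)
  unfold InArc ccwLen at hin
  rw [offset_eq gx hg, offset_eq gx gx'] at hin
  have htn1 : ((x' - x).toNat : ℤ) = x' - x := Int.toNat_of_nonneg (by omega)
  have htn2 : ((y' - x).toNat : ℤ) = y' - x := Int.toNat_of_nonneg (by omega)
  generalize keyReduce m x = κx at *
  generalize keyReduce m x' = κx' at *
  generalize keyReduce m y' = κy at *
  generalize idxK m q x = ix at *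
  generalize idxK m q x' = ix' at *
  generalize idxK m q y' = iy at *
  generalize (x' - x).toNat = d1 at *
  generalize (y' - x).toNat = d2 at *
  split_ifs at hd1 hd2 hin <;> omega

end Staircase

end Literature.Probability.Percolation
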